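import Literature.IUT.HodgeArakelov.GaloisPairCyclotomesOrbitTorsor
import Literature.IUT.HodgeArakelov.GaloisPairRigidityCor111ModulesProofs
import Literature.NumberTheory.GaloisRepresentations.LocalCyclotomicCharacterInfinite
import HarnessLib

/-!
# Bridge B12: the `Aut(G)`-orbit (b) of [IUTchII] Cor. 1.11 at the GENUINE cyclotome is INFINITE — a torsor under
# the cyclotomic-character image `χ(Aut(G)) ⊆ Ẑ^×` (proof-only)

Mochizuki, *Inter-universal Teichmüller theory II*, §1, Corollary 1.11 (b), kurims manuscript (Dec. 2020) p. 49
ll. 22–31: "(b) the `Aut(G)`-orbit [where we recall from [AbsAnab], Proposition 1.2.1, (vi), that `Aut(G)` admits a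
natural cyclotomic character] of isomorphisms `μ_Ẑ(G) ⥲ (l·Δ_Θ)(Π)` `(*bs-Gal_{G,Π})` obtained by composing the
poly-isomorphism induced by applying `μ_Ẑ(−)` to the [inverse of the] full poly-isomorphism of topological groups
`α : Π/Δ ⥲ G` … with the natural isomorphism `μ_Ẑ(G_k) ⥲ μ_Ẑ(Π_X)` of [AbsTopIII], Corollary 1.10, (c)"
[claim: Mochizuki2012, status: disputed] (IUTchII §1 Cor 1.11, kurims p.49); [AbsAnab] Prop. 1.2.1 (vi) p. 10
[cite: MochizukiAbsAnab2004, Prop 1.2.1 (vi) p.10]; J.-P. Serre, *Corps locaux*, IV §4 Prop. 17 (the cyclotomic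
character of a `p`-adic field has infinite image) [cite: SerreLocalFields1979, IV §4 Prop. 17].  Record-only typing
under the claim key `Mochizuki2012` (D-0012, disputed); abc-iut cell, layer L6, `plan/L6/MERGE-MAP.md` §8 row B12
(lineage abc-iut-w4-d024), node `IUTchII:Cor1.11`.  PROOF-ONLY (0 defs); companion of
`GaloisPairCyclotomesOrbitTorsor.lean` (p428875: the `Γ`-orbit (a) is a `Γ`-torsor, the full poly-isomorphism for
`Γ = Ẑ^×`).

STATE BEFORE THIS FILE.  At the B12 instance of record (`GaloisPairRigidityData.ofGaloisCyclotome T R Y`, p416294;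
genuine `μ_Ẑ(G)` = abc-iut-L4-t1's group-theoretic cyclotome, transport `μ_Ẑ(e)`), abc-iut-w6-d001 proved that the
orbit (b) is ONE `Aut(G)`-orbit (`exists_iso_of_mem_orbitB`, `orbitB_eq_of_mem`, p428456) and it is non-empty
(`ofGaloisCyclotome_orbitB_nonempty`).  Its SIZE was not known to the tree.

THIS FILE PROVES (hypothesis of record as in p428875 / abc-iut-L6-t13's producer: an identification
`ε : G_k ≃ₜ* Gal(k̄/k)` with the absolute Galois group of a non-archimedean local field `k` of characteristic `0`):
* `muZhat.congr_smul` — transport `μ_Ẑ(e)` intertwines the `G`-module structures (cyclotomic characters);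
* `muZhat.smul_range_infinite_absoluteGalois` — **`G_k` acts on `μ_Ẑ(G_k)` through INFINITELY MANY distinct
  automorphisms** (via local class field theory `μ_Ẑ(G_k) ≅ Λ(k̄ˣ)` equivariantly, abc-iut-L4/L6-t11's
  `TorsionReciprocityData.muZhatEquiv_smul_coe`, a generator of `Λ(k̄ˣ)`, and the tree's theorem that the `p`-adic
  cyclotomic character of `G_k` has infinite image, `cyclotomicCharacter_range_infinite_of_valuation_lt_one`,
  `p` = the residue characteristic); `IsoClass.smul_range_infinite` — the same for every isomorph `G` of `G_k`;
* `GaloisPairRigidityData.galCyclotomeMap_conj_eq_toMulAut` — `μ_Ẑ(conj_g)` IS the module action `g • (·)`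
  (pointwise form = `galCyclotomeMap_conj` of `LogThetaLattice/MultiradialityRemarksRmk211ivGenuine`, p430248,
  whose hypothesis «some `g` acts non-trivially» is DISCHARGED here by `IsoClass.exists_smul_ne`);
  `orbitB_smul_trans_mem` — the orbit (b) is stable under these translates; **`orbitB_infinite`** — Cor. 1.11 (b)'s
  `Aut(G)`-orbit `(*bs-Gal_{G,Π})` is INFINITE at every `(Π, G)`, for every twist/rigidity/`Π`-input `T`, `R`, `Y`;
* with the genuine twist (`ofGaloisCyclotomeZHat`, p419279): `existsUnique_twist_of_mem_orbitB` — any two members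
  differ by a UNIQUE `Ẑ^×`-twist; `twist_trans_mem_orbitB_iff` — a twist `χ(u)` translates the orbit into itself
  iff `χ(u) = μ_Ẑ(σ)` for an automorphism `σ` of `G`, i.e. **`(*bs-Gal_{G,Π})` is a TORSOR under the image
  `χ(Aut(G)) ⊆ Ẑ^×` of the cyclotomic character of `Aut(G)`** ("`Aut(G)` admits a natural cyclotomic character"),
  and `setOf_twist_eq_galCyclotomeMap_infinite` — that image is INFINITE (it contains `χ(Inn(G))`).
So BOTH printed poly-isomorphisms of Cor. 1.11 are genuinely "poly" at the genuine instance — (a) a `Γ`-torsor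
(p428875), (b) a `χ(Aut(G))`-torsor, infinite — whereas the degenerate witnesses collapse them to points.

HONEST FRAMING: classical content (local class field theory, the `p`-adic cyclotomic character of a `p`-adic field)
applied to the cell's typed interfaces; nothing of abc-iut-L6-t1 / w5-d089 / w6-d001 / L4 is edited or restated;
no definition, no named `Prop` fact; nothing here bears on [IUTchIII] Cor. 3.12 and no side is taken; typed ≠ endorsed.
-/

namespace Literature.AnabelianGeometry.AbsoluteAnabelian

open Literature.NumberTheory.GaloisRepresentations
open ValuativeRel
open scoped ValuativeRel

universe u

namespace muZhat

variable {G G' : Type u} [Group G] [TopologicalSpace G] [IsTopologicalGroup G] [CompactSpace G]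
  [Group G'] [TopologicalSpace G'] [IsTopologicalGroup G'] [CompactSpace G']

/-- Transport `μ_Ẑ(e)` along `e : G ≃ₜ* G'` intertwines the `G`- and `G'`-module structures of the group-theoretic
cyclotomes (conjugation actions = cyclotomic characters): `μ_Ẑ(e) (g • ζ) = e(g) • μ_Ẑ(e) ζ`.
[cite: MochizukiAbsTopIII2015, Cor 1.10 (i) p.42] -/
theorem congr_smul (e : G ≃ₜ* G') (g : G) (ζ : muZhat G) : muZhat.congr e (g • ζ) = e g • muZhat.congr e ζ := by
  refine Subtype.ext (funext fun n => ?_)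
  change Multiplicative.ofAdd (muQZ.map e
      (muQZ.map (conjContinuousMulEquiv g) (Multiplicative.toAdd ((ζ : ℕ+ → _) n)))) =
    Multiplicative.ofAdd (muQZ.map (conjContinuousMulEquiv (e g))
      (muQZ.map e (Multiplicative.toAdd ((ζ : ℕ+ → _) n))))
  rw [← muQZ.map_trans, ← muQZ.map_trans]
  congr 1
  exact muQZ.map_congr (fun x => by simp [map_mul, map_inv]) _

/-- **`G_k` acts on `μ_Ẑ(G_k)` through infinitely many distinct automorphisms** (`k` a non-archimedean local field
of characteristic `0`): the conjugation action `σ ↦ (σ • ·)` on abc-iut-L4-t1's group-theoretic cyclotome has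
INFINITE image in `Aut(μ_Ẑ(G_k))`.  Proof: `μ_Ẑ(G_k) ≅ Λ(k̄ˣ)` `G_k`-equivariantly (local class field theory);
on a generator `ξ` of `Λ(k̄ˣ)` the action at the `p^m`-th component is `ξ_{p^m} ↦ ξ_{p^m}^{χ_p(σ) mod p^m}`, so equal
actions force equal `p`-adic cyclotomic characters, whose image is infinite (Serre, *Corps locaux* IV §4).
[cite: SerreLocalFields1979, IV §4 Prop. 17] -/
theorem smul_range_infinite_absoluteGalois (k : Type u) [Field k] [CharZero k] [ValuativeRel k]
    [TopologicalSpace k] [IsNonarchimedeanLocalField k] :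
    (Set.range (MulDistribMulAction.toMulAut (Field.absoluteGaloisGroup k)
      (muZhat (Field.absoluteGaloisGroup k)))).Infinite := by
  classical
  -- the residue characteristic `p` of `k`
  have hp : (ringChar 𝓀[k]).Prime := CharP.char_is_prime 𝓀[k] _
  haveI : Fact (ringChar 𝓀[k]).Prime := ⟨hp⟩
  haveI : NeZero (ringChar 𝓀[k]) := ⟨hp.ne_zero⟩
  have hpv : valuation k (ringChar 𝓀[k] : k) < 1 := by
    have hmem : ((ringChar 𝓀[k] : ℕ) : 𝒪[k]) ∈ 𝓂[k] := by
      rw [← IsLocalRing.residue_eq_zero_iff, map_natCast]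
      exact CharP.cast_eq_zero 𝓀[k] (ringChar 𝓀[k])
    have h : valuation k (((ringChar 𝓀[k] : ℕ) : 𝒪[k]) : k) < 1 :=
      Valuation.Integer.not_isUnit_iff_valuation_lt_one.mp ((IsLocalRing.mem_maximalIdeal _).mp hmem)
    simpa using h
  haveI : NeZero ((ringChar 𝓀[k] : ℕ) : k) := ⟨Nat.cast_ne_zero.2 hp.ne_zero⟩
  set p : ℕ := ringChar 𝓀[k] with hp_def
  -- local class field theory and a generator of `Λ(k̄ˣ)`
  obtain ⟨D⟩ := nonempty_torsionReciprocityData k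
  obtain ⟨ξ, hξ⟩ := EtaleTheta.cyclotome.exists_generator (R := AlgebraicClosure k)
    (EtaleTheta.cyclotome.exists_isPrimitiveRoot_of_isSepClosed (AlgebraicClosure k))
  -- equal actions on `μ_Ẑ(G_k)` ⇒ equal `p`-adic cyclotomic characters
  have key : ∀ σ τ : Field.absoluteGaloisGroup k,
      MulDistribMulAction.toMulAut (Field.absoluteGaloisGroup k) (muZhat (Field.absoluteGaloisGroup k)) σ =
        MulDistribMulAction.toMulAut (Field.absoluteGaloisGroup k) (muZhat (Field.absoluteGaloisGroup k)) τ →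
      GaloisRep.cyclotomicCharacter k p σ = GaloisRep.cyclotomicCharacter k p τ := by
    intro σ τ h
    have hζ : σ • D.muZhatEquiv.symm ξ = τ • D.muZhatEquiv.symm ξ := MulEquiv.congr_fun h (D.muZhatEquiv.symm ξ)
    apply Units.ext
    refine PadicInt.ext_of_toZModPow.mp fun m => ?_
    let n : ℕ+ := ⟨p ^ m, pow_pos hp.pos m⟩
    have hroot : IsPrimitiveRoot (((ξ : ℕ+ → (AlgebraicClosure k)ˣ) n : (AlgebraicClosure k)ˣ) :
        AlgebraicClosure k) (p ^ m) := IsPrimitiveRoot.coe_units_iff.mpr (hξ n)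
    have hpow : (((ξ : ℕ+ → (AlgebraicClosure k)ˣ) n : (AlgebraicClosure k)ˣ) : AlgebraicClosure k) ^ p ^ m = 1 :=
      hroot.pow_eq_one
    have hcomp : σ • ((((D.muZhatEquiv (D.muZhatEquiv.symm ξ) : EtaleTheta.cyclotome (AlgebraicClosure k)ˣ) :
          ℕ+ → (AlgebraicClosure k)ˣ) n : (AlgebraicClosure k)ˣ) : AlgebraicClosure k) =
        τ • ((((D.muZhatEquiv (D.muZhatEquiv.symm ξ) : EtaleTheta.cyclotome (AlgebraicClosure k)ˣ) :
          ℕ+ → (AlgebraicClosure k)ˣ) n : (AlgebraicClosure k)ˣ) : AlgebraicClosure k) := by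
      rw [← D.muZhatEquiv_smul_coe σ, ← D.muZhatEquiv_smul_coe τ, hζ]
    rw [MulEquiv.apply_symm_apply, GaloisRep.cyclotomicCharacter_spec k p (k := m) σ _ hpow,
      GaloisRep.cyclotomicCharacter_spec k p (k := m) τ _ hpow] at hcomp
    exact ZMod.val_injective _ (hroot.pow_inj (ZMod.val_lt _) (ZMod.val_lt _) hcomp)
  -- if the action had finite image, so would the cyclotomic character
  intro hfin
  refine cyclotomicCharacter_range_infinite_of_valuation_lt_one k (p := p) hpv ?_
  refine (hfin.image fun a : MulAut (muZhat (Field.absoluteGaloisGroup k)) =>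
      if h : ∃ σ, MulDistribMulAction.toMulAut (Field.absoluteGaloisGroup k)
          (muZhat (Field.absoluteGaloisGroup k)) σ = a
      then GaloisRep.cyclotomicCharacter k p h.choose else 1).subset ?_
  rintro _ ⟨σ, rfl⟩
  have h : ∃ σ', MulDistribMulAction.toMulAut (Field.absoluteGaloisGroup k) (muZhat (Field.absoluteGaloisGroup k)) σ' =
      MulDistribMulAction.toMulAut (Field.absoluteGaloisGroup k) (muZhat (Field.absoluteGaloisGroup k)) σ :=
    ⟨σ, rfl⟩
  refine ⟨_, ⟨σ, rfl⟩, ?_⟩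
  simp only [dif_pos h]
  exact key _ _ h.choose_spec

/-- The same for every compact group `G ≅ G_k` (transport along the identification).
[cite: SerreLocalFields1979, IV §4 Prop. 17] -/
theorem smul_range_infinite_of_continuousMulEquiv (k : Type u) [Field k] [CharZero k] [ValuativeRel k]
    [TopologicalSpace k] [IsNonarchimedeanLocalField k] (e : G ≃ₜ* Field.absoluteGaloisGroup k) :
    (Set.range (MulDistribMulAction.toMulAut G (muZhat G))).Infinite := by
  classical
  intro hfin
  apply smul_range_infinite_absoluteGalois k
  -- `Φ_{G_k}(σ) = μ_Ẑ(e) ∘ Φ_G(e⁻¹ σ) ∘ μ_Ẑ(e)⁻¹`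
  have hconj : ∀ σ : Field.absoluteGaloisGroup k,
      MulDistribMulAction.toMulAut (Field.absoluteGaloisGroup k) (muZhat (Field.absoluteGaloisGroup k)) σ =
        ((muZhat.congr e).symm.trans (MulDistribMulAction.toMulAut G (muZhat G) (e.symm σ))).trans
          (muZhat.congr e) := by
    intro σ
    refine MulEquiv.ext fun ξ => ?_
    change σ • ξ = muZhat.congr e (e.symm σ • (muZhat.congr e).symm ξ)
    rw [congr_smul, e.apply_symm_apply, MulEquiv.apply_symm_apply]
  refine (hfin.image fun a : MulAut (muZhat G) => ((muZhat.congr e).symm.trans a).trans (muZhat.congr e)).subset ?_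
  rintro _ ⟨σ, rfl⟩
  exact ⟨_, ⟨e.symm σ, rfl⟩, (hconj σ).symm⟩

end muZhat

end Literature.AnabelianGeometry.AbsoluteAnabelian

namespace Literature.IUT.HodgeArakelov

open CategoryTheory
open Literature.AnabelianGeometry.AbsoluteAnabelian

universe u

namespace IsoClass

variable {P : TopGroup.{u}} [CompactSpace P] (k : Type u) [Field k] [CharZero k] [ValuativeRel k]
  [TopologicalSpace k] [IsNonarchimedeanLocalField k] (ε : P ≃ₜ* Field.absoluteGaloisGroup k)

include ε

/-- **For every isomorph `G` of `G_k`, the `G`-module `μ_Ẑ(G)` has INFINITELY MANY distinct `g • (·)`** (the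
cyclotomic character of `G` on its own group-theoretic cyclotome has infinite image).
[claim: Mochizuki2012, status: disputed] (IUTchII §1 Cor 1.11, kurims p.49) -/
theorem smul_range_infinite (X : IsoClass P) :
    haveI := X.compactSpace_carrier
    (Set.range (MulDistribMulAction.toMulAut X.G X.galCyclotome)).Infinite := by
  haveI := X.compactSpace_carrier
  exact muZhat.smul_range_infinite_of_continuousMulEquiv k ((Classical.choice X.iso).trans ε)

/-- In particular **some `g ∈ G` moves some element of `μ_Ẑ(G)`** (the cyclotomic character of `G` on `μ_Ẑ(G)` is
not trivial) — the hypothesis `hχ` of `ofGaloisCyclotomeZHat_orbitB_nontrivial`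
(`LogThetaLattice/MultiradialityRemarksRmk211ivGenuine`, p430248), DISCHARGED for every `G ≅ G_k`.
[claim: Mochizuki2012, status: disputed] (IUTchII §1 Cor 1.11, kurims p.49) -/
theorem exists_smul_ne (X : IsoClass P) :
    haveI := X.compactSpace_carrier
    ∃ (g : X.G) (ζ : X.galCyclotome), g • ζ ≠ ζ := by
  haveI := X.compactSpace_carrier
  by_contra h
  push Not at h
  apply smul_range_infinite k ε X
  refine (Set.finite_singleton (1 : MulAut X.galCyclotome)).subset ?_
  rintro _ ⟨g, rfl⟩
  exact MulEquiv.ext fun ζ => h g ζ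

end IsoClass

/-! ## [IUTchII] Cor. 1.11 (b): the `Aut(G)`-orbit `(*bs-Gal_{G,Π})` of the instance of record is infinite -/

namespace GaloisPairRigidityData

variable {S : ThetaSetting.{u}} [CompactSpace S.Gk] {A : AbsTopMonoids S} (k : Type u) [Field k] [CharZero k]
  [ValuativeRel k] [TopologicalSpace k] [IsNonarchimedeanLocalField k] (ε : S.Gk ≃ₜ* Field.absoluteGaloisGroup k)
  (T : GalTwistInput S) (R : GalRigidityInput A) (Y : GalThetaSyncInput A)

/-- `μ_Ẑ(conj_g) = g • (·)`: applying `μ_Ẑ(−)` to the inner automorphism `conj_g ∈ Aut(G)` gives the `G`-module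
action of `g` on `μ_Ẑ(G)` — the cyclotomic character of `G` is the restriction to `Inn(G)` of that of `Aut(G)`
(definitional for abc-iut-L4-t1's cyclotome; `MulEquiv` form of the pointwise `galCyclotomeMap_conj` of p430248).
[claim: Mochizuki2012, status: disputed] (IUTchII §1 Cor 1.11, kurims p.49) -/
theorem galCyclotomeMap_conj_eq_toMulAut (G : IsoClass S.Gk) (g : G.G) :
    haveI := G.compactSpace_carrier
    IsoClass.galCyclotomeMap (show G ⟶ G from conjContinuousMulEquiv g) =
      MulDistribMulAction.toMulAut G.G G.galCyclotome g :=
  MulEquiv.ext fun _ => Subtype.ext (funext fun _ => rfl)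

/-- The orbit (b) is stable under the translates `(g • ·) ≫ φ`, `g ∈ G` (they are the members indexed by
`conj_g ≫ e`). [claim: Mochizuki2012, status: disputed] (IUTchII §1 Cor 1.11, kurims p.49) -/
theorem orbitB_smul_trans_mem (P : IsoClass S.PiX) (G : IsoClass S.Gk) (g : G.G)
    {φ : G.galCyclotome ≃* (ofGaloisCyclotome T R Y).lDeltaTheta P} (hφ : φ ∈ (ofGaloisCyclotome T R Y).orbitB P G) :
    haveI := G.compactSpace_carrier
    (MulDistribMulAction.toMulAut G.G G.galCyclotome g).trans φ ∈ (ofGaloisCyclotome T R Y).orbitB P G := by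
  haveI := G.compactSpace_carrier
  rw [← galCyclotomeMap_conj_eq_toMulAut]
  exact (ofGaloisCyclotome T R Y).orbitB_map_mem P _ hφ

include ε in
/-- **Cor. 1.11 (b)'s `Aut(G)`-orbit `(*bs-Gal_{G,Π})` is INFINITE** at the B12 instance of record, at every
`(Π, G)` and for every twist / rigidity / `Π`-input: it contains the translates of any member by the infinitely many
distinct `g • (·)`, `g ∈ G` (`IsoClass.smul_range_infinite`). [claim: Mochizuki2012, status: disputed]
(IUTchII §1 Cor 1.11, kurims p.49) -/
theorem orbitB_infinite (P : IsoClass S.PiX) (G : IsoClass S.Gk) : ((ofGaloisCyclotome T R Y).orbitB P G).Infinite := by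
  haveI := G.compactSpace_carrier
  obtain ⟨φ₀, hφ₀⟩ := ofGaloisCyclotome_orbitB_nonempty T R Y P G
  have hinj : Set.InjOn (fun a : MulAut G.galCyclotome => a.trans φ₀)
      (Set.range (MulDistribMulAction.toMulAut G.G G.galCyclotome)) := by
    intro a _ b _ h
    exact MulEquiv.ext fun ζ => φ₀.injective (MulEquiv.congr_fun h ζ)
  refine ((IsoClass.smul_range_infinite k ε G).image hinj).mono ?_
  rintro _ ⟨_, ⟨g, rfl⟩, rfl⟩
  exact orbitB_smul_trans_mem T R Y P G g hφ₀

include ε in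
/-- With the GENUINE twist (`ofGaloisCyclotomeZHat`, p419279): **any two members of `(*bs-Gal_{G,Π})` differ by a
UNIQUE `Ẑ^×`-twist** — the cyclotomic character `χ(σ)` of the automorphism `σ ∈ Aut(G)` relating them
(`Aut(μ_Ẑ(G)) = Ẑ^×`, p428875). [claim: Mochizuki2012, status: disputed] (IUTchII §1 Cor 1.11, kurims p.49) -/
theorem existsUnique_twist_of_mem_orbitB (P : IsoClass S.PiX) (G : IsoClass S.Gk)
    {φ ψ : G.galCyclotome ≃* (ofGaloisCyclotomeZHat R Y).lDeltaTheta P}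
    (hφ : φ ∈ (ofGaloisCyclotomeZHat R Y).orbitB P G) (hψ : ψ ∈ (ofGaloisCyclotomeZHat R Y).orbitB P G) :
    ∃! u : ZHatUnits, ψ = (G.galCyclotomeTwist u).trans φ := by
  obtain ⟨σ, hσ⟩ := (ofGaloisCyclotomeZHat R Y).exists_iso_of_mem_orbitB P G hφ hψ
  obtain ⟨u, hu, -⟩ := IsoClass.existsUnique_galCyclotomeTwist_eq k ε G (IsoClass.galCyclotomeMap σ)
  have hψu : ψ = (G.galCyclotomeTwist u).trans φ := by
    rw [hσ, hu]
    rfl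
  refine ⟨u, hψu, fun v hv => IsoClass.galCyclotomeTwist_injective k ε G (MulEquiv.ext fun ζ => ?_)⟩
  have h := MulEquiv.congr_fun (hv.symm.trans hψu) ζ
  exact φ.injective h

/-- **The torsor group of `(*bs-Gal_{G,Π})` is the image `χ(Aut(G)) ⊆ Ẑ^×` of the cyclotomic character of
`Aut(G)`**: for a member `φ`, the twist-translate `χ(u) ≫ φ` is again a member iff `χ(u) = μ_Ẑ(σ)` for some
automorphism `σ` of the topological group `G`. [claim: Mochizuki2012, status: disputed] (IUTchII §1 Cor 1.11, kurims p.49) -/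
theorem twist_trans_mem_orbitB_iff (P : IsoClass S.PiX) (G : IsoClass S.Gk)
    {φ : G.galCyclotome ≃* (ofGaloisCyclotomeZHat R Y).lDeltaTheta P}
    (hφ : φ ∈ (ofGaloisCyclotomeZHat R Y).orbitB P G) (u : ZHatUnits) :
    (G.galCyclotomeTwist u).trans φ ∈ (ofGaloisCyclotomeZHat R Y).orbitB P G ↔
      ∃ σ : G ⟶ G, G.galCyclotomeTwist u = IsoClass.galCyclotomeMap σ := by
  constructor
  · intro h
    obtain ⟨σ, hσ⟩ := (ofGaloisCyclotomeZHat R Y).exists_iso_of_mem_orbitB P G hφ h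
    refine ⟨σ, MulEquiv.ext fun ζ => φ.injective ?_⟩
    exact MulEquiv.congr_fun hσ ζ
  · rintro ⟨σ, hσ⟩
    rw [hσ]
    exact (ofGaloisCyclotomeZHat R Y).orbitB_map_mem P σ hφ

include ε in
/-- **`χ(Aut(G))` is INFINITE**: the set of `u ∈ Ẑ^×` whose twist is `μ_Ẑ(σ)` for some automorphism `σ` of `G`
contains the characters of all inner automorphisms, which are infinitely many (`IsoClass.smul_range_infinite`).
[claim: Mochizuki2012, status: disputed] (IUTchII §1 Cor 1.11, kurims p.49) -/
theorem setOf_twist_eq_galCyclotomeMap_infinite (G : IsoClass S.Gk) :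
    {u : ZHatUnits | ∃ σ : G ⟶ G, G.galCyclotomeTwist u = IsoClass.galCyclotomeMap σ}.Infinite := by
  haveI := G.compactSpace_carrier
  intro hfin
  apply IsoClass.smul_range_infinite k ε G
  refine (hfin.image fun u : ZHatUnits => G.galCyclotomeTwist u).subset ?_
  rintro _ ⟨g, rfl⟩
  obtain ⟨u, hu, -⟩ := IsoClass.existsUnique_galCyclotomeTwist_eq k ε G
    (MulDistribMulAction.toMulAut G.G G.galCyclotome g)
  exact ⟨u, ⟨conjContinuousMulEquiv g, hu.trans (galCyclotomeMap_conj_eq_toMulAut G g).symm⟩, hu⟩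

include ε in
/-- The same infinitude at the instance over Cor. 1.10's family (`ofGaloisCyclotomeCor110`, p417560), whose
`(l·Δ_Θ)(Π)` IS Cor. 1.10's. [claim: Mochizuki2012, status: disputed] (IUTchII §1 Cor 1.11, kurims p.49) -/
theorem ofGaloisCyclotomeCor110_orbitB_infinite (D : MonoThetaRigidityData S) (C : GalCorPiXInput A D)
    (P : IsoClass S.PiX) (G : IsoClass S.Gk) :
    ((ofGaloisCyclotomeCor110 T R D C).orbitB P G).Infinite :=
  orbitB_infinite k ε T R _ P G

end GaloisPairRigidityData

/-- **On the functor of record** (`cor111FunctorGaloisZHat`, p419279): the `(*bs-Gal_{G,Π})`-entry of the tuple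
assigned to `(Π, G)` is an infinite set of isomorphisms. [claim: Mochizuki2012, status: disputed]
(IUTchII §1 Cor 1.11, kurims p.49) -/
theorem cor111FunctorGaloisZHat_obj_orbB_infinite {S : ThetaSetting.{u}} [CompactSpace S.Gk] {A : AbsTopMonoids S}
    (k : Type u) [Field k] [CharZero k] [ValuativeRel k] [TopologicalSpace k] [IsNonarchimedeanLocalField k]
    (ε : S.Gk ≃ₜ* Field.absoluteGaloisGroup k) (R : GalRigidityInput A) (Y : GalThetaSyncInput A)
    (Γ : Subgroup ZHatUnits) (Γ' : Type u) [Group Γ'] (X : IsoClass S.PiX × TwistedIsoClass S.Gk Γ') :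
    ((cor111FunctorGaloisZHat R Y Γ Γ').obj X).orbB.Infinite :=
  GaloisPairRigidityData.orbitB_infinite k ε _ R Y X.1 X.2.toIso

end Literature.IUT.HodgeArakelov
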